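import Literature.NumberTheory.LFunctions.Zhang2022.Section12ShiftedSmallCircle
import Literature.NumberTheory.LFunctions.Zhang2022.RepairGapLemma58Premise
import HarnessLib

/-!
# Zhang (2022), rescue GAP/BED (D-0124 (3)(4)): §12 Lemmas 12.2–12.3 — the small circle around `s = β₆ − w`
# (model comparison, `L ≠ 0` on the circle, the two bare circle evaluations) under the minimum premise `‖L(1,χ)‖ ≤ 𝓛⁻¹⁵`

Topic `Literature/NumberTheory/LFunctions/Zhang2022` (Landau–Siegel audit tree; verdict-neutral).
Y. Zhang, *Discrete mean estimates and the Landau–Siegel zero*, arXiv:2211.02515v1 (2022)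
[Zhang2022LandauSiegel] — **an unrefereed manuscript under adjudication; nothing in this file asserts or
denies its Theorems 1–2, and nothing here is a claim about Landau–Siegel zeros. The programme SEARCHES and
TYPES; no claim about Landau–Siegel zeros, Theorems 1–2 of arXiv:2211.02515 or a repaired Margin232 until a
kernel theorem says so.**

The tree file `Section12ShiftedSmallCircle` (lane ZHANG-L, WP12) proves the small-contour inputs of `Z22:§12.u025` / `u030` with the
explicit hypothesis `hA : ‖L(1,χ)‖ ≤ 𝓛⁻²⁰²²`, used ONLY through Lemma 5.8 (`Lemma58.lemma_5_8_of_le`, twice: the annulus model comparison and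
`L(1+s,χ) ≠ 0` on the annulus) and otherwise THREADED. Lemma 5.8 consumes exactly `𝓛⁻¹⁵` (`Repair.Gap.lemma58_of_norm_le_pow15`, bed-2 g4
p561913), so the six (A)-threading theorems are re-run VERBATIM with `hA : ‖L(1,χ)‖ ≤ 𝓛⁻¹⁵` and the 5.8 door re-pointed:
**`norm_quot_sub_model_annulus_pow15`**, `norm_quot_sub_model_on_shifted_sphere_pow15`, **`norm_LFunction_ge_annulus_pow15`**,
`LFunction_ne_zero_on_shifted_sphere_pow15`, `norm_circ_true_sub_main_kernel2_pow15`, `norm_circ_true_sub_main_kernel1_pow15` (same constants,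
same thresholds; the docstrings below are the tree's, read with `𝓛⁻²⁰²²` ↦ `𝓛⁻¹⁵` in the hypothesis). Inputs of the `ω₁`-circle evaluation and
of the u025 assembly (leaf h1212 `Typed.Sec12C.Eq1212`) at (A)-exponent 15. Theorems only; no definition, no named fact; nothing about (A)
itself.

## References

* Y. Zhang, arXiv:2211.02515v1 (2022), §12 proofs of Lemmas 12.2–12.3, pp. 69–70 (tex L3528–L3586); §8 Lemma 8.4 (proof) p. 47; §5 Lemma 5.8.
  [cite: Zhang2022LandauSiegel, §12 Lemmas 12.2–12.3]
* H. L. Montgomery, R. C. Vaughan, *Multiplicative Number Theory I*, CUP 2007, §6.2. [cite: MontgomeryVaughan2007, §6.2]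
-/

noncomputable section

open Complex Real Set Finset Metric

namespace Literature.NumberTheory.LFunctions.Zhang2022.Lemma84

open Skeleton

section AnnulusPow15

variable {D : ℕ} [NeZero D] (χ : DirichletCharacter ℂ D) (c' : ℝ)

/-- **The model comparison on the annulus `α/2 ≤ |s| ≤ 7α/2`** (the core of `norm_Phi_sub_model_le`,
shift-agnostic). Let `χ` be primitive mod `D`, `𝓛 = log D ≥ 3`, (A) `‖L(1,χ)‖ ≤ 𝓛⁻²⁰²²`, `K ≥ 7 + 15|c′|`
with `Kπ ≤ 𝓛⁸`, `0 < ℓ₀ ≤ |L′(1,χ)|` with `(1 + 16e^{9/2}π²K²)𝓛⁻¹⁵ ≤ ℓ₀α/4`, and `𝔲` with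
`‖𝔲(u) − Π(d,r)‖ ≤ C₈₃𝓛⁻⁸Π̂` for `|u − 1| ≤ 5α` (`Π̂ = ∏_{q∣dr}(1−q⁻¹)⁻¹`, Lemma 8.3 (iii′)). Then for every
`s` with `α/2 ≤ |s| ≤ 7α/2`:
`‖𝔲(1+s)L(1+s+β_{j+1})L(1+s+β_{j+2})/L(1+s) − Π(d,r)L′(1,χ)(s+β_{j+1})(s+β_{j+2})/s‖ ≤
  Π̂²(1+16e^{9/2}π²K²)𝓛⁻¹⁵(24K²+2K) + 32K³(C₈₃𝓛⁻⁸Π̂)(2e^{9/2}(1+𝓛)𝓛)α`.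
[cite: Zhang2022LandauSiegel, §8 Lemma 8.4 (proof, "By Lemma 5.5 and 5.6 … O(𝓛⁻¹⁵)"); §12 proof of Lemma 12.2, p. 69] -/
theorem norm_quot_sub_model_annulus_pow15 (hprim : χ.IsPrimitive) (h𝓛 : 3 ≤ Real.log D)
    (hA : ‖χ.LFunction 1‖ ≤ 1 / Real.log D ^ 15) (j : ℕ) {d r : ℕ} (hd : d ≠ 0) (hr : r ≠ 0)
    (U : ℂ → ℂ) {C₈₃ K ℓ₀ : ℝ} (hC₈₃ : 0 ≤ C₈₃) (hK : 7 + 15 * |c'| ≤ K)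
    (hKL : K * π ≤ Real.log D ^ 8) (hℓ₀ : 0 < ℓ₀) (hℓ : ℓ₀ ≤ ‖deriv χ.LFunction 1‖)
    (hE : (1 + 16 * Real.exp (9 / 2) * π ^ 2 * K ^ 2) / Real.log D ^ 15 ≤ ℓ₀ * alpha D / 4)
    (hU3 : ∀ s : ℂ, ‖s - 1‖ ≤ 5 * alpha D → ‖U s - PiW χ d r‖ ≤
      C₈₃ * (ell D ^ 8)⁻¹ * ∏ q ∈ (d * r).primeFactors, (1 - (q : ℝ)⁻¹)⁻¹)
    {s : ℂ} (hs_lo : alpha D / 2 ≤ ‖s‖) (hs_hi : ‖s‖ ≤ 7 * alpha D / 2) :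
    ‖U (1 + s) * χ.LFunction (1 + s + betaJ c' D (j + 1)) *
          χ.LFunction (1 + s + betaJ c' D (j + 2)) / χ.LFunction (1 + s) -
        PiW χ d r * deriv χ.LFunction 1 * (s + betaJ c' D (j + 1)) * (s + betaJ c' D (j + 2)) / s‖ ≤
      (∏ q ∈ (d * r).primeFactors, (1 - (q : ℝ)⁻¹)⁻¹) ^ 2 *
          ((1 + 16 * Real.exp (9 / 2) * π ^ 2 * K ^ 2) / Real.log D ^ 15) * (24 * K ^ 2 + 2 * K) +
        32 * K ^ 3 * (C₈₃ * (ell D ^ 8)⁻¹ * ∏ q ∈ (d * r).primeFactors, (1 - (q : ℝ)⁻¹)⁻¹) *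
          (2 * Real.exp (9 / 2) * (1 + Real.log D) * Real.log D) * alpha D := by
  set 𝓛 : ℝ := Real.log D with h𝓛def
  set α : ℝ := alpha D with hαdef
  set βa : ℂ := betaJ c' D (j + 1) with hβadef
  set βb : ℂ := betaJ c' D (j + 2) with hβbdef
  set hatPi : ℝ := ∏ q ∈ (d * r).primeFactors, (1 - (q : ℝ)⁻¹)⁻¹ with hhatPi
  set E : ℝ := (1 + 16 * Real.exp (9 / 2) * π ^ 2 * K ^ 2) / 𝓛 ^ 15 with hEdef
  set ℓ : ℂ := deriv χ.LFunction 1 with hℓdef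
  have hℓ1 : 1 ≤ ell D := by rw [ell]; linarith
  have hℓ2 : 2 ≤ ell D := by rw [ell]; linarith
  have hα0 : 0 < α := alpha_pos' (by linarith)
  have hαeq : α = π / 𝓛 ^ 9 := alpha_eq D
  have hαℓ : α * ell D ≤ 1 := alpha_mul_ell_le_one hℓ2
  have hK1 : 1 ≤ K := by linarith [abs_nonneg c']
  -- sizes of the shifts
  have hβ : ∀ i : ℕ, ‖betaJ c' D i‖ ≤ 3 * α * (1 + 5 * |c'|) := by
    intro i
    have h := norm_betaJ_le c' D i hα0.le (by linarith : 0 ≤ ell D)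
    refine h.trans ?_
    have : 5 * |c'| * alpha D * ell D ≤ 5 * |c'| := by
      calc 5 * |c'| * alpha D * ell D = 5 * |c'| * (alpha D * ell D) := by ring
        _ ≤ 5 * |c'| * 1 := by gcongr
        _ = 5 * |c'| := mul_one _
    rw [← hαdef] at this ⊢
    nlinarith [abs_nonneg c']
  have hsK : ‖s‖ ≤ K * α := by nlinarith [abs_nonneg c']
  have hAK : ‖s + βa‖ ≤ K * α := by
    calc ‖s + βa‖ ≤ ‖s‖ + ‖βa‖ := norm_add_le _ _
      _ ≤ 7 * α / 2 + 3 * α * (1 + 5 * |c'|) := add_le_add hs_hi (hβ _)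
      _ ≤ K * α := by nlinarith [abs_nonneg c']
  have hBK : ‖s + βb‖ ≤ K * α := by
    calc ‖s + βb‖ ≤ ‖s‖ + ‖βb‖ := norm_add_le _ _
      _ ≤ 7 * α / 2 + 3 * α * (1 + 5 * |c'|) := add_le_add hs_hi (hβ _)
      _ ≤ K * α := by nlinarith [abs_nonneg c']
  -- Lemma 5.8 at the three points
  have h58 : ∀ z : ℂ, ‖z‖ ≤ K * α → ‖χ.LFunction (1 + z) - ℓ * z‖ ≤ E := by
    intro z hz
    have hz' : ‖(1 + z) - 1‖ ≤ K * π / Real.log D ^ 9 := by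
      rw [add_sub_cancel_left, ← h𝓛def]
      calc ‖z‖ ≤ K * α := hz
        _ = K * π / 𝓛 ^ 9 := by rw [hαeq]; ring
    have h := Repair.Gap.lemma58_of_norm_le_pow15 χ hprim h𝓛 hA hKL hz'
    rw [add_sub_cancel_left] at h
    exact h
  have ha : ‖χ.LFunction (1 + s + βa) - ℓ * (s + βa)‖ ≤ E := by
    rw [add_assoc]; exact h58 _ hAK
  have hb : ‖χ.LFunction (1 + s + βb) - ℓ * (s + βb)‖ ≤ E := by
    rw [add_assoc]; exact h58 _ hBK
  have h0 : ‖χ.LFunction (1 + s) - ℓ * s‖ ≤ E := h58 _ hsK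
  -- Lemma 8.3 (iii′) at `1 + s`
  have hu : ‖U (1 + s) - PiW χ d r‖ ≤ C₈₃ * (ell D ^ 8)⁻¹ * hatPi :=
    hU3 _ (by rw [add_sub_cancel_left]; linarith)
  have hE0 : 0 ≤ E := by positivity
  have hEU0 : 0 ≤ C₈₃ * (ell D ^ 8)⁻¹ * hatPi := by
    have h0 : 0 ≤ hatPi := Finset.prod_nonneg fun q hq => by
      have hq2 : (2 : ℝ) ≤ q := by exact_mod_cast (Nat.prime_of_mem_primeFactors hq).two_le
      have : (q : ℝ)⁻¹ ≤ 1 / 2 := by rw [inv_eq_one_div]; gcongr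
      exact inv_nonneg.2 (by linarith)
    positivity
  have hEℓ : E ≤ ℓ₀ * α / 4 := hE
  -- the algebraic comparison
  have hcmp := norm_quot_sub_model_le (u := U (1 + s)) (La := χ.LFunction (1 + s + βa))
    (Lb := χ.LFunction (1 + s + βb)) (L0 := χ.LFunction (1 + s)) (Pv := PiW χ d r) (ℓ := ℓ)
    (s := s) (A := s + βa) (B := s + βb) hα0 hK1 hℓ₀ hℓ hE0 hEU0 hEℓ ha hb h0 hu hs_lo hsK hAK hBK
  refine hcmp.trans ?_
  -- `‖Π‖ ≤ Π̂²`, `‖ℓ‖ ≤ 2e^{9/2}(1+𝓛)𝓛`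
  have hPi : ‖PiW χ d r‖ ≤ hatPi ^ 2 := norm_PiW_le_prodInv χ hd hr
  have hℓle : ‖ℓ‖ ≤ 2 * Real.exp (9 / 2) * (1 + 𝓛) * 𝓛 :=
    Lemma31.norm_deriv_LFunction_le_near_one χ h𝓛 hprim (w := 1)
      (by rw [sub_self, norm_zero]; positivity)
  have hK0 : 0 ≤ 24 * K ^ 2 + 2 * K := by positivity
  gcongr

end AnnulusPow15

section ShiftedCirclePow15

variable {D : ℕ}

/-- **The model comparison at `u = 1 − β₆ + w + z` on the circle `|z − (β₆ − w)| = 3α`** (`|w| = α`): the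
annulus lemma at `s = z + w − β₆` (`|s| = 3α`). This is the pointwise input for the small-contour step of
`Z22:§12.u025` / `u030` when the contour is taken around `s = β₆ − w`.
[cite: Zhang2022LandauSiegel, §12 proof of Lemma 12.2, p. 69; proof of Lemma 12.3, p. 70] -/
theorem norm_quot_sub_model_on_shifted_sphere_pow15 [NeZero D] (χ : DirichletCharacter ℂ D) (c' : ℝ)
    (hprim : χ.IsPrimitive) (h𝓛 : 3 ≤ Real.log D)
    (hA : ‖χ.LFunction 1‖ ≤ 1 / Real.log D ^ 15) (j : ℕ) {d r : ℕ} (hd : d ≠ 0) (hr : r ≠ 0)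
    (U : ℂ → ℂ) {C₈₃ K ℓ₀ : ℝ} (hC₈₃ : 0 ≤ C₈₃) (hK : 7 + 15 * |c'| ≤ K)
    (hKL : K * π ≤ Real.log D ^ 8) (hℓ₀ : 0 < ℓ₀) (hℓ : ℓ₀ ≤ ‖deriv χ.LFunction 1‖)
    (hE : (1 + 16 * Real.exp (9 / 2) * π ^ 2 * K ^ 2) / Real.log D ^ 15 ≤ ℓ₀ * alpha D / 4)
    (hU3 : ∀ s : ℂ, ‖s - 1‖ ≤ 5 * alpha D → ‖U s - PiW χ d r‖ ≤
      C₈₃ * (ell D ^ 8)⁻¹ * ∏ q ∈ (d * r).primeFactors, (1 - (q : ℝ)⁻¹)⁻¹)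
    {w : ℂ} (hw : ‖w‖ = alpha D) {z : ℂ} (hz : z ∈ sphere (beta6 D - w) (3 * alpha D)) :
    ‖U (1 - beta6 D + w + z) * χ.LFunction (1 - beta6 D + w + z + betaJ c' D (j + 1)) *
          χ.LFunction (1 - beta6 D + w + z + betaJ c' D (j + 2)) / χ.LFunction (1 - beta6 D + w + z) -
        PiW χ d r * deriv χ.LFunction 1 * (z + w - beta6 D + betaJ c' D (j + 1)) *
          (z + w - beta6 D + betaJ c' D (j + 2)) / (z + w - beta6 D)‖ ≤
      (∏ q ∈ (d * r).primeFactors, (1 - (q : ℝ)⁻¹)⁻¹) ^ 2 *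
          ((1 + 16 * Real.exp (9 / 2) * π ^ 2 * K ^ 2) / Real.log D ^ 15) * (24 * K ^ 2 + 2 * K) +
        32 * K ^ 3 * (C₈₃ * (ell D ^ 8)⁻¹ * ∏ q ∈ (d * r).primeFactors, (1 - (q : ℝ)⁻¹)⁻¹) *
          (2 * Real.exp (9 / 2) * (1 + Real.log D) * Real.log D) * alpha D := by
  have hℓ1 : 1 ≤ ell D := by rw [ell]; linarith
  have hα : 0 < alpha D := alpha_pos' (by linarith)
  obtain ⟨h1, -, -, -⟩ := sphere_shift_bounds hα hw hz
  have hs_lo : alpha D / 2 ≤ ‖z + w - beta6 D‖ := by rw [h1]; linarith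
  have hs_hi : ‖z + w - beta6 D‖ ≤ 7 * alpha D / 2 := by rw [h1]; linarith
  have h := norm_quot_sub_model_annulus_pow15 χ c' hprim h𝓛 hA j hd hr U hC₈₃ hK hKL hℓ₀ hℓ hE hU3
    hs_lo hs_hi
  have e : 1 + (z + w - beta6 D) = 1 - beta6 D + w + z := by ring
  rw [e] at h
  exact h

/-- **`L(1+s,χ) ≠ 0` on the annulus `α/2 ≤ |s| ≤ Kα`, from Lemma 5.8 alone**: with
`‖L(1+s,χ) − L′(1,χ)s‖ ≤ (1+16e^{9/2}π²K²)𝓛⁻¹⁵ ≤ ℓ₀α/4` and `‖L′(1,χ)s‖ ≥ ℓ₀α/2`, one gets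
`‖L(1+s,χ)‖ ≥ ℓ₀α/4 > 0` — so the exceptional zero `ρ̃` (inside `|s| < α/2`) is the only zero near `1` the
small contour has to avoid, and no zero-free input is needed ON the contour.
[cite: Zhang2022LandauSiegel, §5 Lemma 5.8; §12 proof of Lemma 12.2, p. 69] -/
theorem norm_LFunction_ge_annulus_pow15 [NeZero D] (χ : DirichletCharacter ℂ D) (hprim : χ.IsPrimitive)
    (h𝓛 : 3 ≤ Real.log D) (hA : ‖χ.LFunction 1‖ ≤ 1 / Real.log D ^ 15) {K ℓ₀ : ℝ}
    (hKL : K * π ≤ Real.log D ^ 8) (hℓ₀ : 0 < ℓ₀) (hℓ : ℓ₀ ≤ ‖deriv χ.LFunction 1‖)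
    (hE : (1 + 16 * Real.exp (9 / 2) * π ^ 2 * K ^ 2) / Real.log D ^ 15 ≤ ℓ₀ * alpha D / 4)
    {s : ℂ} (hs_lo : alpha D / 2 ≤ ‖s‖) (hs_hi : ‖s‖ ≤ K * alpha D) :
    ℓ₀ * alpha D / 4 ≤ ‖χ.LFunction (1 + s)‖ ∧ χ.LFunction (1 + s) ≠ 0 := by
  have hℓ1 : 1 ≤ ell D := by rw [ell]; linarith
  have hα : 0 < alpha D := alpha_pos' (by linarith)
  have hαeq : alpha D = π / Real.log D ^ 9 := alpha_eq D
  have hs' : ‖(1 + s) - 1‖ ≤ K * π / Real.log D ^ 9 := by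
    rw [add_sub_cancel_left]
    calc ‖s‖ ≤ K * alpha D := hs_hi
      _ = K * π / Real.log D ^ 9 := by rw [hαeq]; ring
  have h58 := Repair.Gap.lemma58_of_norm_le_pow15 χ hprim h𝓛 hA hKL hs'
  rw [add_sub_cancel_left] at h58
  -- `‖ℓ s‖ ≥ ℓ₀ α/2`
  have hmain : ℓ₀ * alpha D / 2 ≤ ‖deriv χ.LFunction 1 * s‖ := by
    rw [norm_mul]
    calc ℓ₀ * alpha D / 2 = ℓ₀ * (alpha D / 2) := by ring
      _ ≤ ‖deriv χ.LFunction 1‖ * ‖s‖ := mul_le_mul hℓ hs_lo (by positivity) (norm_nonneg _)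
  have hlow : ℓ₀ * alpha D / 4 ≤ ‖χ.LFunction (1 + s)‖ := by
    have h := norm_sub_norm_le (deriv χ.LFunction 1 * s) (χ.LFunction (1 + s))
    rw [norm_sub_rev] at h
    linarith [h58.trans hE]
  refine ⟨hlow, fun h0 => ?_⟩
  rw [h0, norm_zero] at hlow
  have : 0 < ℓ₀ * alpha D / 4 := by positivity
  linarith

/-- **`L(u,χ) ≠ 0` on the circle `|z − (β₆ − w)| = 3α`**, `u = 1 − β₆ + w + z`, `|w| = α` (with
`‖L(u,χ)‖ ≥ ℓ₀α/4`): the annulus lemma at `s = z + w − β₆`, `|s| = 3α` (`K ≥ 3`). This discharges the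
hypothesis `hLnz` of `circleIntegrable_true_kernel2/1`. [cite: Zhang2022LandauSiegel, §5 Lemma 5.8; §12 proof of Lemma 12.2, p. 69] -/
theorem LFunction_ne_zero_on_shifted_sphere_pow15 [NeZero D] (χ : DirichletCharacter ℂ D)
    (hprim : χ.IsPrimitive) (h𝓛 : 3 ≤ Real.log D) (hA : ‖χ.LFunction 1‖ ≤ 1 / Real.log D ^ 15)
    {K ℓ₀ : ℝ} (hK3 : 3 ≤ K) (hKL : K * π ≤ Real.log D ^ 8) (hℓ₀ : 0 < ℓ₀)
    (hℓ : ℓ₀ ≤ ‖deriv χ.LFunction 1‖)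
    (hE : (1 + 16 * Real.exp (9 / 2) * π ^ 2 * K ^ 2) / Real.log D ^ 15 ≤ ℓ₀ * alpha D / 4)
    {w : ℂ} (hw : ‖w‖ = alpha D) {z : ℂ} (hz : z ∈ sphere (beta6 D - w) (3 * alpha D)) :
    ℓ₀ * alpha D / 4 ≤ ‖χ.LFunction (1 - beta6 D + w + z)‖ ∧
      χ.LFunction (1 - beta6 D + w + z) ≠ 0 := by
  have hℓ1 : 1 ≤ ell D := by rw [ell]; linarith
  have hα : 0 < alpha D := alpha_pos' (by linarith)
  obtain ⟨h1, -, -, -⟩ := sphere_shift_bounds hα hw hz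
  have hs_lo : alpha D / 2 ≤ ‖z + w - beta6 D‖ := by rw [h1]; linarith
  have hs_hi : ‖z + w - beta6 D‖ ≤ K * alpha D := by rw [h1]; nlinarith
  have h := norm_LFunction_ge_annulus_pow15 χ hprim h𝓛 hA hKL hℓ₀ hℓ hE hs_lo hs_hi
  have e : 1 + (z + w - beta6 D) = 1 - beta6 D + w + z := by ring
  rw [e] at h
  exact h

/-- **The small-circle step of `Z22:§12.u025` in one call.** For `χ` primitive, `χ ≠ χ₀`, `𝓛 = log D ≥ 3`,
(A) `‖L(1,χ)‖ ≤ 𝓛⁻²⁰²²`, `α < 1/30`, `K ≥ 7 + 15|c′|` with `Kπ ≤ 𝓛⁸`, `0 < ℓ₀ ≤ |L′(1,χ)|` with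
`(1+16e^{9/2}π²K²)𝓛⁻¹⁵ ≤ ℓ₀α/4`, `𝔲` holomorphic on `σ > 9/10` with `‖𝔲(u) − Π(d,r)‖ ≤ C₈₃𝓛⁻⁸Π̂` on
`|u−1| ≤ 5α` (Lemma 8.3 (i), (iii′)), `|w| = α` and `1 ≤ X₁, X₂ ≤ P`:
`‖(2πi)⁻¹∮_{C(β₆−w,3α)} 𝔲(u)L(u+β_{j+1})L(u+β_{j+2})/L(u)·(X₂^z − X₁^z)/z dz
   − Π(d,r)L′(1,χ)·β_{j+1}β_{j+2}(X₂^{β₆−w} − X₁^{β₆−w})/(β₆−w)‖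
 ≤ 12e^{11π/2}·((1+16e^{9/2}π²K²)(24K²+2K) + 128e^{9/2}πK³C₈₃)·Π̂²·𝓛⁻¹⁵` (`u = 1 − β₆ + w + z`) — the value
subtracted is `Π L′(1,χ)·circ025` (`Typed.Sec12B.circ025_eq`). Circle-integrability and `L(u) ≠ 0` on the
circle are discharged here (`LFunction_ne_zero_on_shifted_sphere_pow15`, `circleIntegrable_true_kernel2`).
[cite: Zhang2022LandauSiegel, §12 proof of Lemma 12.2, p. 69, tex L3534] -/
theorem norm_circ_true_sub_main_kernel2_pow15 [NeZero D] (χ : DirichletCharacter ℂ D) (c' : ℝ)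
    (hprim : χ.IsPrimitive) (hχ : χ ≠ 1) (h𝓛 : 3 ≤ Real.log D)
    (hA : ‖χ.LFunction 1‖ ≤ 1 / Real.log D ^ 15) (hα30 : alpha D < 1 / 30)
    (j : ℕ) {d r : ℕ} (hd : d ≠ 0) (hr : r ≠ 0)
    (U : ℂ → ℂ) (hUd : DifferentiableOn ℂ U {s : ℂ | 9 / 10 < s.re})
    {C₈₃ K ℓ₀ : ℝ} (hC₈₃ : 0 ≤ C₈₃) (hK : 7 + 15 * |c'| ≤ K)
    (hKL : K * π ≤ Real.log D ^ 8) (hℓ₀ : 0 < ℓ₀) (hℓ : ℓ₀ ≤ ‖deriv χ.LFunction 1‖)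
    (hE : (1 + 16 * Real.exp (9 / 2) * π ^ 2 * K ^ 2) / Real.log D ^ 15 ≤ ℓ₀ * alpha D / 4)
    (hU3 : ∀ s : ℂ, ‖s - 1‖ ≤ 5 * alpha D → ‖U s - PiW χ d r‖ ≤
      C₈₃ * (ell D ^ 8)⁻¹ * ∏ q ∈ (d * r).primeFactors, (1 - (q : ℝ)⁻¹)⁻¹)
    {w : ℂ} (hw : ‖w‖ = alpha D) {X₁ X₂ : ℝ}
    (hX₁ : 1 ≤ X₁) (hX₁P : X₁ ≤ bigP D) (hX₂ : 1 ≤ X₂) (hX₂P : X₂ ≤ bigP D) :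
    ‖(2 * π * I)⁻¹ * (∮ z in C(beta6 D - w, 3 * alpha D),
          U (1 - beta6 D + w + z) * χ.LFunction (1 - beta6 D + w + z + betaJ c' D (j + 1)) *
              χ.LFunction (1 - beta6 D + w + z + betaJ c' D (j + 2)) /
              χ.LFunction (1 - beta6 D + w + z) *
            ((((X₂ : ℝ) : ℂ) ^ z - ((X₁ : ℝ) : ℂ) ^ z) / z)) -
        PiW χ d r * deriv χ.LFunction 1 *
          (betaJ c' D (j + 1) * betaJ c' D (j + 2) *
            ((((X₂ : ℝ) : ℂ) ^ (beta6 D - w) - ((X₁ : ℝ) : ℂ) ^ (beta6 D - w)) / (beta6 D - w)))‖ ≤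
      12 * Real.exp (11 * π / 2) *
        (((1 + 16 * Real.exp (9 / 2) * π ^ 2 * K ^ 2) * (24 * K ^ 2 + 2 * K) +
            128 * Real.exp (9 / 2) * π * K ^ 3 * C₈₃) *
          (∏ q ∈ (d * r).primeFactors, (1 - (q : ℝ)⁻¹)⁻¹) ^ 2 / Real.log D ^ 15) := by
  have hℓ1 : 1 ≤ ell D := by rw [ell]; linarith
  have hlog1 : 1 ≤ Real.log D := by linarith
  have hα : 0 < alpha D := alpha_pos' (by linarith)
  have hK1 : 0 ≤ K := by linarith [abs_nonneg c']
  have hK3 : 3 ≤ K := by linarith [abs_nonneg c']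
  have hX₁0 : 0 < X₁ := by linarith
  have hX₂0 : 0 < X₂ := by linarith
  -- `L(u) ≠ 0` on the circle, hence circle-integrability of the true integrand
  have hLnz : ∀ z ∈ sphere (beta6 D - w) (3 * alpha D), χ.LFunction (1 - beta6 D + w + z) ≠ 0 :=
    fun z hz => (LFunction_ne_zero_on_shifted_sphere_pow15 χ hprim h𝓛 hA hK3 hKL hℓ₀ hℓ hE hw hz).2
  have hFi := circleIntegrable_true_kernel2 χ hχ c' j hα hα30 hw U hUd hLnz hX₁0 hX₂0
  -- the pointwise comparison on the circle, with `Δ ≤ C·Π̂²·𝓛⁻¹⁵`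
  have hΔ : ∀ z ∈ sphere (beta6 D - w) (3 * alpha D),
      ‖U (1 - beta6 D + w + z) * χ.LFunction (1 - beta6 D + w + z + betaJ c' D (j + 1)) *
            χ.LFunction (1 - beta6 D + w + z + betaJ c' D (j + 2)) /
            χ.LFunction (1 - beta6 D + w + z) -
          PiW χ d r * deriv χ.LFunction 1 * (z + w - beta6 D + betaJ c' D (j + 1)) *
            (z + w - beta6 D + betaJ c' D (j + 2)) / (z + w - beta6 D)‖ ≤
        ((1 + 16 * Real.exp (9 / 2) * π ^ 2 * K ^ 2) * (24 * K ^ 2 + 2 * K) +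
            128 * Real.exp (9 / 2) * π * K ^ 3 * C₈₃) *
          (∏ q ∈ (d * r).primeFactors, (1 - (q : ℝ)⁻¹)⁻¹) ^ 2 / Real.log D ^ 15 :=
    fun z hz => (norm_quot_sub_model_on_shifted_sphere_pow15 χ c' hprim h𝓛 hA j hd hr U hC₈₃ hK hKL hℓ₀ hℓ
      hE hU3 hw hz).trans (delta_le hlog1 hK1 hC₈₃ (d * r))
  have h := norm_circ_sub_residue_kernel2_le hℓ1 hw hX₁ hX₁P hX₂ hX₂P
    (PiW χ d r * deriv χ.LFunction 1) (betaJ c' D (j + 1)) (betaJ c' D (j + 2)) hFi hΔ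
  refine h.trans (le_of_eq ?_)
  ring

/-- **The small-circle step of `Z22:§12.u030` in one call** (kernel `X₂^z/z`): under the same hypotheses
with `1 ≤ X₂ ≤ P`,
`‖(2πi)⁻¹∮_{C(β₆−w,3α)} 𝔲(u)L(u+β_{j+1})L(u+β_{j+2})/L(u)·X₂^z/z dz
   − Π(d,r)L′(1,χ)·(w − β₆ + β_{j+1} + β_{j+2} + β_{j+1}β_{j+2}(X₂^{β₆−w} − 1)/(β₆−w))‖
 ≤ 6e^{11π/2}·((1+16e^{9/2}π²K²)(24K²+2K) + 128e^{9/2}πK³C₈₃)·Π̂²·𝓛⁻¹⁵` — the value subtracted is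
`Π L′(1,χ)·circ030` (`Typed.Sec12B.U031_holds`, with `∫₁^{X₂}y^{β₆−w−1}dy = (X₂^{β₆−w} − 1)/(β₆−w)`).
[cite: Zhang2022LandauSiegel, §12 proof of Lemma 12.3, p. 70, tex L3564–L3577] -/
theorem norm_circ_true_sub_main_kernel1_pow15 [NeZero D] (χ : DirichletCharacter ℂ D) (c' : ℝ)
    (hprim : χ.IsPrimitive) (hχ : χ ≠ 1) (h𝓛 : 3 ≤ Real.log D)
    (hA : ‖χ.LFunction 1‖ ≤ 1 / Real.log D ^ 15) (hα30 : alpha D < 1 / 30)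
    (j : ℕ) {d r : ℕ} (hd : d ≠ 0) (hr : r ≠ 0)
    (U : ℂ → ℂ) (hUd : DifferentiableOn ℂ U {s : ℂ | 9 / 10 < s.re})
    {C₈₃ K ℓ₀ : ℝ} (hC₈₃ : 0 ≤ C₈₃) (hK : 7 + 15 * |c'| ≤ K)
    (hKL : K * π ≤ Real.log D ^ 8) (hℓ₀ : 0 < ℓ₀) (hℓ : ℓ₀ ≤ ‖deriv χ.LFunction 1‖)
    (hE : (1 + 16 * Real.exp (9 / 2) * π ^ 2 * K ^ 2) / Real.log D ^ 15 ≤ ℓ₀ * alpha D / 4)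
    (hU3 : ∀ s : ℂ, ‖s - 1‖ ≤ 5 * alpha D → ‖U s - PiW χ d r‖ ≤
      C₈₃ * (ell D ^ 8)⁻¹ * ∏ q ∈ (d * r).primeFactors, (1 - (q : ℝ)⁻¹)⁻¹)
    {w : ℂ} (hw : ‖w‖ = alpha D) {X₂ : ℝ} (hX₂ : 1 ≤ X₂) (hX₂P : X₂ ≤ bigP D) :
    ‖(2 * π * I)⁻¹ * (∮ z in C(beta6 D - w, 3 * alpha D),
          U (1 - beta6 D + w + z) * χ.LFunction (1 - beta6 D + w + z + betaJ c' D (j + 1)) *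
              χ.LFunction (1 - beta6 D + w + z + betaJ c' D (j + 2)) /
              χ.LFunction (1 - beta6 D + w + z) *
            (((X₂ : ℝ) : ℂ) ^ z / z)) -
        PiW χ d r * deriv χ.LFunction 1 *
          (w - beta6 D + betaJ c' D (j + 1) + betaJ c' D (j + 2) +
            betaJ c' D (j + 1) * betaJ c' D (j + 2) *
              ((((X₂ : ℝ) : ℂ) ^ (beta6 D - w) - 1) / (beta6 D - w)))‖ ≤
      6 * Real.exp (11 * π / 2) *
        (((1 + 16 * Real.exp (9 / 2) * π ^ 2 * K ^ 2) * (24 * K ^ 2 + 2 * K) +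
            128 * Real.exp (9 / 2) * π * K ^ 3 * C₈₃) *
          (∏ q ∈ (d * r).primeFactors, (1 - (q : ℝ)⁻¹)⁻¹) ^ 2 / Real.log D ^ 15) := by
  have hℓ1 : 1 ≤ ell D := by rw [ell]; linarith
  have hlog1 : 1 ≤ Real.log D := by linarith
  have hα : 0 < alpha D := alpha_pos' (by linarith)
  have hK1 : 0 ≤ K := by linarith [abs_nonneg c']
  have hK3 : 3 ≤ K := by linarith [abs_nonneg c']
  have hX₂0 : 0 < X₂ := by linarith
  obtain ⟨hc0, -, -⟩ := center_shift_bounds hα hw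
  have hLnz : ∀ z ∈ sphere (beta6 D - w) (3 * alpha D), χ.LFunction (1 - beta6 D + w + z) ≠ 0 :=
    fun z hz => (LFunction_ne_zero_on_shifted_sphere_pow15 χ hprim h𝓛 hA hK3 hKL hℓ₀ hℓ hE hw hz).2
  have hFi := circleIntegrable_true_kernel1 χ hχ c' j hα hα30 hw U hUd hLnz hX₂0
  have hΔ : ∀ z ∈ sphere (beta6 D - w) (3 * alpha D),
      ‖U (1 - beta6 D + w + z) * χ.LFunction (1 - beta6 D + w + z + betaJ c' D (j + 1)) *
            χ.LFunction (1 - beta6 D + w + z + betaJ c' D (j + 2)) /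
            χ.LFunction (1 - beta6 D + w + z) -
          PiW χ d r * deriv χ.LFunction 1 * (z + w - beta6 D + betaJ c' D (j + 1)) *
            (z + w - beta6 D + betaJ c' D (j + 2)) / (z + w - beta6 D)‖ ≤
        ((1 + 16 * Real.exp (9 / 2) * π ^ 2 * K ^ 2) * (24 * K ^ 2 + 2 * K) +
            128 * Real.exp (9 / 2) * π * K ^ 3 * C₈₃) *
          (∏ q ∈ (d * r).primeFactors, (1 - (q : ℝ)⁻¹)⁻¹) ^ 2 / Real.log D ^ 15 :=
    fun z hz => (norm_quot_sub_model_on_shifted_sphere_pow15 χ c' hprim h𝓛 hA j hd hr U hC₈₃ hK hKL hℓ₀ hℓ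
      hE hU3 hw hz).trans (delta_le hlog1 hK1 hC₈₃ (d * r))
  have h := norm_circ_sub_residue_kernel1_le hℓ1 hw hX₂ hX₂P
    (PiW χ d r * deriv χ.LFunction 1) (betaJ c' D (j + 1)) (betaJ c' D (j + 2)) hFi hΔ
  -- the two closed forms of the model value agree (`β₆ − w ≠ 0`)
  have e : PiW χ d r * deriv χ.LFunction 1 *
        ((betaJ c' D (j + 1) * betaJ c' D (j + 2) * ((X₂ : ℝ) : ℂ) ^ (beta6 D - w) -
            (betaJ c' D (j + 1) - (beta6 D - w)) * (betaJ c' D (j + 2) - (beta6 D - w))) /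
          (beta6 D - w)) =
      PiW χ d r * deriv χ.LFunction 1 *
        (w - beta6 D + betaJ c' D (j + 1) + betaJ c' D (j + 2) +
          betaJ c' D (j + 1) * betaJ c' D (j + 2) *
            ((((X₂ : ℝ) : ℂ) ^ (beta6 D - w) - 1) / (beta6 D - w))) := by
    congr 1
    field_simp
    ring
  rw [e] at h
  exact h

end ShiftedCirclePow15

end Literature.NumberTheory.LFunctions.Zhang2022.Lemma84

end
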